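import Literature.NumberTheory.DiophantineGeometry.AbcShapeFourthMoment
import HarnessLib

/-!
# The Fourier-analytic bound for `B_d` (Bernert, Proposition 3)

Assembling `B_d ≤ N(U,V,W)`, the Cauchy–Schwarz inequalities `N² ≤ E(·,·) E₂(·)`,
`E(·,·)² ≤ E₄ E₄` (`AbcShapeMoments`), the second-moment bound `E₂ ≤ #box · D^d` and the
fourth-moment bound `E₄ ≤ 3 D^d #box² ∏_{i≠j} Xᵢ` (`AbcShapeFourthMoment`) over the three ways of
singling out one of `U, V, W`, we obtain [Bernert2025, Prop. 3]
(`B_d ≪ X^{2λ/3+ε} / P_j^{1/6}`, `P_j = X_jY_jZ_j`, `2 ≤ j`, i.e. exponent `≥ 2`) in the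
explicit multiplicative form

> `B_d^{12} · (X_j Y_j Z_j)² ≤ 729 · D^{12 d} · (#box X · #box Y · #box Z)^8`

(`AbcShapes.shapeCount_pow_mul_le`), for every coordinate `j ≥ 1` (from `0`) and every `D`
bounding the number of divisors of the integers up to the largest value `cᵢ ∏ (2·)^{i+1}`; and
its real form `B_d ≤ 2 D^d (#box X #box Y #box Z)^{2/3} / (X_jY_jZ_j)^{1/6}`
(`AbcShapes.shapeCount_le_fourier`). Theorems 1.2/1.3 of [BernertEtAl2024] (named facts of
`AbcExceptionalSetBounds`) are NOT proved here.

## References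

* [Bernert2025] C. Bernert, *The exceptional set in the abc conjecture*, arXiv:2506.13364 (2025),
  Proposition 3.
* [BernertEtAl2024] C. Bernert, T. Browning, J. D. Lichtman, J. Teräväinen, *Bounds on the
  exceptional set in the abc conjecture*, arXiv:2410.12234, Proposition 3.1 (v1).
-/

noncomputable section

open Finset

namespace Literature.NumberTheory.DiophantineGeometry

namespace AbcShapes

/-! ### The two other arrangements of `u + v = w` -/

/-- `N(U,V,W)² ≤ E(U,W) · E₂(V)`: write `u + v = w` as the coincidence `w - u = v`.
[cite: Bernert2025, Proposition 3] -/
theorem tripleCount_sq_le_XZ {d : ℕ} (c₁ c₂ c₃ : ℕ) (X Y Z : Fin d → ℕ) :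
    tripleCount c₁ c₂ c₃ X Y Z ^ 2 ≤ mixedEnergy c₁ X c₃ Z * energy2 c₂ Y := by
  classical
  have h1 : tripleCount c₁ c₂ c₃ X Y Z ≤ coinc (dyadicBox X ×ˢ dyadicBox Z) (dyadicBox Y)
      (fun p => vals c₃ p.2 - vals c₁ p.1) (vals c₂) := by
    refine coinc_le_coinc_of_injOn (fun t => ((t.1.1, t.2), t.1.2)) ?_ (fun t _ t' _ h => ?_)
    · rintro ⟨⟨x, y⟩, z⟩ ht heq
      simp only [mem_product] at ht heq ⊢
      exact ⟨⟨⟨ht.1.1, ht.2⟩, ht.1.2⟩, by linarith⟩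
    · simp only [Prod.mk.injEq] at h
      exact Prod.ext (Prod.ext h.1.1 h.2) h.1.2
  have h2 : coinc (dyadicBox X ×ˢ dyadicBox Z) (dyadicBox X ×ˢ dyadicBox Z)
      (fun p => vals c₃ p.2 - vals c₁ p.1) (fun p => vals c₃ p.2 - vals c₁ p.1) ≤
      mixedEnergy c₁ X c₃ Z := by
    refine coinc_le_coinc_of_injOn (fun t => ((t.2.1, t.1.2), (t.1.1, t.2.2))) ?_
      (fun t _ t' _ h => ?_)
    · rintro ⟨⟨x, z⟩, ⟨x', z'⟩⟩ ht heq
      simp only [mem_product] at ht heq ⊢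
      exact ⟨⟨⟨ht.2.1, ht.1.2⟩, ht.1.1, ht.2.2⟩, by linarith⟩
    · simp only [Prod.mk.injEq] at h
      exact Prod.ext (Prod.ext h.2.1 h.1.2) (Prod.ext h.1.1 h.2.2)
  calc tripleCount c₁ c₂ c₃ X Y Z ^ 2 ≤ _ := Nat.pow_le_pow_left h1 2
    _ ≤ _ := coinc_sq_le _ _ _ _
    _ ≤ mixedEnergy c₁ X c₃ Z * energy2 c₂ Y := Nat.mul_le_mul_right _ h2

/-- `N(U,V,W)² ≤ E(V,W) · E₂(U)`: write `u + v = w` as the coincidence `w - v = u`.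
[cite: Bernert2025, Proposition 3] -/
theorem tripleCount_sq_le_YZ {d : ℕ} (c₁ c₂ c₃ : ℕ) (X Y Z : Fin d → ℕ) :
    tripleCount c₁ c₂ c₃ X Y Z ^ 2 ≤ mixedEnergy c₂ Y c₃ Z * energy2 c₁ X := by
  classical
  have h1 : tripleCount c₁ c₂ c₃ X Y Z ≤ coinc (dyadicBox Y ×ˢ dyadicBox Z) (dyadicBox X)
      (fun p => vals c₃ p.2 - vals c₂ p.1) (vals c₁) := by
    refine coinc_le_coinc_of_injOn (fun t => ((t.1.2, t.2), t.1.1)) ?_ (fun t _ t' _ h => ?_)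
    · rintro ⟨⟨x, y⟩, z⟩ ht heq
      simp only [mem_product] at ht heq ⊢
      exact ⟨⟨⟨ht.1.2, ht.2⟩, ht.1.1⟩, by linarith⟩
    · simp only [Prod.mk.injEq] at h
      exact Prod.ext (Prod.ext h.2 h.1.1) h.1.2
  have h2 : coinc (dyadicBox Y ×ˢ dyadicBox Z) (dyadicBox Y ×ˢ dyadicBox Z)
      (fun p => vals c₃ p.2 - vals c₂ p.1) (fun p => vals c₃ p.2 - vals c₂ p.1) ≤
      mixedEnergy c₂ Y c₃ Z := by
    refine coinc_le_coinc_of_injOn (fun t => ((t.2.1, t.1.2), (t.1.1, t.2.2))) ?_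
      (fun t _ t' _ h => ?_)
    · rintro ⟨⟨y, z⟩, ⟨y', z'⟩⟩ ht heq
      simp only [mem_product] at ht heq ⊢
      exact ⟨⟨⟨ht.2.1, ht.1.2⟩, ht.1.1, ht.2.2⟩, by linarith⟩
    · simp only [Prod.mk.injEq] at h
      exact Prod.ext (Prod.ext h.2.1 h.1.2) (Prod.ext h.1.1 h.2.2)
  calc tripleCount c₁ c₂ c₃ X Y Z ^ 2 ≤ _ := Nat.pow_le_pow_left h1 2
    _ ≤ _ := coinc_sq_le _ _ _ _
    _ ≤ mixedEnergy c₂ Y c₃ Z * energy2 c₁ X := Nat.mul_le_mul_right _ h2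

/-! ### Bernert's Proposition 3 -/

/-- One arrangement: `N⁴ ≤ E₄(U) E₄(V) E₂(W)²`. [cite: Bernert2025, Proposition 3] -/
theorem tripleCount_pow_four_le {d : ℕ} (c₁ c₂ c₃ : ℕ) (X Y Z : Fin d → ℕ) :
    tripleCount c₁ c₂ c₃ X Y Z ^ 4 ≤ energy4 c₁ X * energy4 c₂ Y * energy2 c₃ Z ^ 2 := by
  have h1 := tripleCount_sq_le c₁ c₂ c₃ X Y Z
  have h2 := mixedEnergy_sq_le c₁ c₂ X Y
  calc tripleCount c₁ c₂ c₃ X Y Z ^ 4 = (tripleCount c₁ c₂ c₃ X Y Z ^ 2) ^ 2 := by ring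
    _ ≤ (mixedEnergy c₁ X c₂ Y * energy2 c₃ Z) ^ 2 := Nat.pow_le_pow_left h1 2
    _ = mixedEnergy c₁ X c₂ Y ^ 2 * energy2 c₃ Z ^ 2 := by ring
    _ ≤ energy4 c₁ X * energy4 c₂ Y * energy2 c₃ Z ^ 2 := Nat.mul_le_mul_right _ h2

/-- **Bernert's Proposition 3, multiplicative form.** Let `c₁, c₂, c₃ ≥ 1`, boxes `X, Y, Z` with
positive parameters in `d' + 1` variables, `j` a coordinate with `j ≥ 1`, `T` a common bound for
the values `cᵢ ∏ (2·)^{i+1}` and `D` a bound for `τ(m)`, `1 ≤ m ≤ T`. Then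
`B^{12} (X_jY_jZ_j)² ≤ 729 D^{12(d'+1)} (#box X #box Y #box Z)^8` for `B = B_{d'+1}(c; X, Y, Z)`
(geometric mean of the three arrangements of `N⁴ ≤ E₄E₄E₂²` with `E₂ ≤ N D^d`,
`E₄ ≤ 3D^d N² ∏_{i≠j}`). [cite: Bernert2025, Proposition 3] -/
theorem shapeCount_pow_mul_le {d' : ℕ} {c₁ c₂ c₃ : ℕ} (hc₁ : 0 < c₁) (hc₂ : 0 < c₂)
    (hc₃ : 0 < c₃) (X Y Z : Fin (d' + 1) → ℕ) (hX : ∀ i, 0 < X i) (hY : ∀ i, 0 < Y i)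
    (hZ : ∀ i, 0 < Z i) (j : Fin (d' + 1)) (hj : 1 ≤ (j : ℕ)) {T D : ℕ}
    (hTX : c₁ * shapeVal (fun i => 2 * X i) ≤ T) (hTY : c₂ * shapeVal (fun i => 2 * Y i) ≤ T)
    (hTZ : c₃ * shapeVal (fun i => 2 * Z i) ≤ T)
    (hD : ∀ m : ℕ, m ≠ 0 → m ≤ T → m.divisors.card ≤ D) :
    shapeCount c₁ c₂ c₃ X Y Z ^ 12 * (X j * Y j * Z j) ^ 2 ≤
      729 * D ^ (12 * (d' + 1)) *
        ((dyadicBox X).card * (dyadicBox Y).card * (dyadicBox Z).card) ^ 8 := by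
  set B := shapeCount c₁ c₂ c₃ X Y Z with hB
  set N := tripleCount c₁ c₂ c₃ X Y Z with hN
  set NX := (dyadicBox X).card with hNX
  set NY := (dyadicBox Y).card with hNY
  set NZ := (dyadicBox Z).card with hNZ
  set RX := ∏ i : Fin d', X (j.succAbove i) with hRX
  set RY := ∏ i : Fin d', Y (j.succAbove i) with hRY
  set RZ := ∏ i : Fin d', Z (j.succAbove i) with hRZ
  -- the moment bounds
  have hE4X : energy4 c₁ X ≤ 3 * D ^ (d' + 1) * NX ^ 2 * RX :=
    energy4_le hc₁ X hX j hj fun m hm hmT => hD m hm (hmT.trans hTX)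
  have hE4Y : energy4 c₂ Y ≤ 3 * D ^ (d' + 1) * NY ^ 2 * RY :=
    energy4_le hc₂ Y hY j hj fun m hm hmT => hD m hm (hmT.trans hTY)
  have hE4Z : energy4 c₃ Z ≤ 3 * D ^ (d' + 1) * NZ ^ 2 * RZ :=
    energy4_le hc₃ Z hZ j hj fun m hm hmT => hD m hm (hmT.trans hTZ)
  have hE2 : ∀ {c : ℕ} (_ : 0 < c) (W : Fin (d' + 1) → ℕ) (_ : ∀ i, 0 < W i)
      (_ : c * shapeVal (fun i => 2 * W i) ≤ T), energy2 c W ≤ (dyadicBox W).card * D ^ (d' + 1) := by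
    intro c hc W hW hTW
    have hval : ∀ z ∈ dyadicBox W, shapeVal z ≠ 0 ∧ shapeVal z ≤ T := by
      intro z hz
      have hzpos : ∀ i, 0 < z i := fun i => lt_of_lt_of_le (hW i) ((mem_dyadicBox.mp hz) i).1
      refine ⟨(shapeVal_pos hzpos).ne', ?_⟩
      calc shapeVal z ≤ shapeVal (fun i => 2 * W i) :=
            shapeVal_mono fun i => ((mem_dyadicBox.mp hz) i).2.le
        _ ≤ c * shapeVal (fun i => 2 * W i) := Nat.le_mul_of_pos_left _ hc
        _ ≤ T := hTW
    exact energy2_le hc W (fun z hz => hD _ (hval z hz).1 (hval z hz).2) fun z hz => (hval z hz).1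
  have hE2X := hE2 hc₁ X hX hTX
  have hE2Y := hE2 hc₂ Y hY hTY
  have hE2Z := hE2 hc₃ Z hZ hTZ
  -- the three arrangements
  have hBN : B ≤ N := shapeCount_le_tripleCount _ _ _ _ _ _
  have hA : N ^ 4 ≤ (3 * D ^ (d' + 1) * NX ^ 2 * RX) * (3 * D ^ (d' + 1) * NY ^ 2 * RY) * (NZ * D ^ (d' + 1)) ^ 2 := by
    refine (tripleCount_pow_four_le c₁ c₂ c₃ X Y Z).trans ?_
    gcongr
  have hBxz : N ^ 4 ≤ (3 * D ^ (d' + 1) * NX ^ 2 * RX) * (3 * D ^ (d' + 1) * NZ ^ 2 * RZ) * (NY * D ^ (d' + 1)) ^ 2 := by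
    have h1 := tripleCount_sq_le_XZ c₁ c₂ c₃ X Y Z
    have h2 := mixedEnergy_sq_le c₁ c₃ X Z
    calc N ^ 4 = (N ^ 2) ^ 2 := by ring
      _ ≤ (mixedEnergy c₁ X c₃ Z * energy2 c₂ Y) ^ 2 := Nat.pow_le_pow_left h1 2
      _ = mixedEnergy c₁ X c₃ Z ^ 2 * energy2 c₂ Y ^ 2 := by ring
      _ ≤ (energy4 c₁ X * energy4 c₃ Z) * energy2 c₂ Y ^ 2 := Nat.mul_le_mul_right _ h2
      _ ≤ _ := by gcongr
  have hCyz : N ^ 4 ≤ (3 * D ^ (d' + 1) * NY ^ 2 * RY) * (3 * D ^ (d' + 1) * NZ ^ 2 * RZ) * (NX * D ^ (d' + 1)) ^ 2 := by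
    have h1 := tripleCount_sq_le_YZ c₁ c₂ c₃ X Y Z
    have h2 := mixedEnergy_sq_le c₂ c₃ Y Z
    calc N ^ 4 = (N ^ 2) ^ 2 := by ring
      _ ≤ (mixedEnergy c₂ Y c₃ Z * energy2 c₁ X) ^ 2 := Nat.pow_le_pow_left h1 2
      _ = mixedEnergy c₂ Y c₃ Z ^ 2 * energy2 c₁ X ^ 2 := by ring
      _ ≤ (energy4 c₂ Y * energy4 c₃ Z) * energy2 c₁ X ^ 2 := Nat.mul_le_mul_right _ h2
      _ ≤ _ := by gcongr
  -- `∏_{i ≠ j} · X_j = N`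
  have hsplit : ∀ (W : Fin (d' + 1) → ℕ),
      (dyadicBox W).card = (∏ i : Fin d', W (j.succAbove i)) * W j := by
    intro W
    rw [card_dyadicBox, Fin.prod_univ_succAbove _ j, mul_comm]
  have hX' : NX = RX * X j := hsplit X
  have hY' : NY = RY * Y j := hsplit Y
  have hZ' : NZ = RZ * Z j := hsplit Z
  -- multiply the three
  have hprod : N ^ 12 ≤ ((3 * D ^ (d' + 1) * NX ^ 2 * RX) * (3 * D ^ (d' + 1) * NY ^ 2 * RY) * (NZ * D ^ (d' + 1)) ^ 2) *
      (((3 * D ^ (d' + 1) * NX ^ 2 * RX) * (3 * D ^ (d' + 1) * NZ ^ 2 * RZ) * (NY * D ^ (d' + 1)) ^ 2) *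
      ((3 * D ^ (d' + 1) * NY ^ 2 * RY) * (3 * D ^ (d' + 1) * NZ ^ 2 * RZ) * (NX * D ^ (d' + 1)) ^ 2)) := by
    calc N ^ 12 = N ^ 4 * (N ^ 4 * N ^ 4) := by ring
      _ ≤ _ := Nat.mul_le_mul hA (Nat.mul_le_mul hBxz hCyz)
  calc B ^ 12 * (X j * Y j * Z j) ^ 2 ≤ N ^ 12 * (X j * Y j * Z j) ^ 2 :=
        Nat.mul_le_mul_right _ (Nat.pow_le_pow_left hBN 12)
    _ ≤ _ := Nat.mul_le_mul_right _ hprod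
    _ = 729 * D ^ (12 * (d' + 1)) * (NX * NY * NZ) ^ 8 := by rw [hX', hY', hZ']; ring

/-- **Bernert's Proposition 3, real form**: under the hypotheses of `shapeCount_pow_mul_le`,
`B_{d'+1}(c; X, Y, Z) ≤ 2 D^{d'+1} (#box X · #box Y · #box Z)^{2/3} / (X_jY_jZ_j)^{1/6}`
(`729^{1/12} = √3 ≤ 2`). In the source's notation (`∏ Pᵢ ~ X^λ`, `D ≪ X^ε`):
`B_d ≪ X^{2λ/3+ε}/P_j^{1/6}`. [cite: Bernert2025, Proposition 3] -/
theorem shapeCount_le_fourier {d' : ℕ} {c₁ c₂ c₃ : ℕ} (hc₁ : 0 < c₁) (hc₂ : 0 < c₂)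
    (hc₃ : 0 < c₃) (X Y Z : Fin (d' + 1) → ℕ) (hX : ∀ i, 0 < X i) (hY : ∀ i, 0 < Y i)
    (hZ : ∀ i, 0 < Z i) (j : Fin (d' + 1)) (hj : 1 ≤ (j : ℕ)) {T D : ℕ}
    (hTX : c₁ * shapeVal (fun i => 2 * X i) ≤ T) (hTY : c₂ * shapeVal (fun i => 2 * Y i) ≤ T)
    (hTZ : c₃ * shapeVal (fun i => 2 * Z i) ≤ T)
    (hD : ∀ m : ℕ, m ≠ 0 → m ≤ T → m.divisors.card ≤ D) :
    (shapeCount c₁ c₂ c₃ X Y Z : ℝ) ≤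
      2 * (D : ℝ) ^ (d' + 1) *
        (((dyadicBox X).card * (dyadicBox Y).card * (dyadicBox Z).card : ℕ) : ℝ) ^ (2 / 3 : ℝ) /
        ((X j * Y j * Z j : ℕ) : ℝ) ^ (1 / 6 : ℝ) := by
  have h := shapeCount_pow_mul_le hc₁ hc₂ hc₃ X Y Z hX hY hZ j hj hTX hTY hTZ hD
  set B := shapeCount c₁ c₂ c₃ X Y Z with hB
  set P : ℕ := X j * Y j * Z j with hP
  set N : ℕ := (dyadicBox X).card * (dyadicBox Y).card * (dyadicBox Z).card with hN
  have hP0 : (0 : ℝ) < P := by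
    rw [hP]; exact_mod_cast Nat.mul_pos (Nat.mul_pos (hX j) (hY j)) (hZ j)
  have hN0 : (0 : ℝ) ≤ N := Nat.cast_nonneg _
  -- real form of the multiplicative inequality
  have h' : (B : ℝ) ^ (12 : ℕ) * (P : ℝ) ^ (2 : ℕ) ≤
      729 * (D : ℝ) ^ (12 * (d' + 1)) * (N : ℝ) ^ (8 : ℕ) := by
    exact_mod_cast h
  have e1 : (3 : ℝ) ^ ((1 / 2 : ℝ) * (12 : ℕ)) = 729 := by
    rw [show (1 / 2 : ℝ) * (12 : ℕ) = ((6 : ℕ) : ℝ) by norm_num, Real.rpow_natCast]; norm_num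
  have e2 : (N : ℝ) ^ ((2 / 3 : ℝ) * (12 : ℕ)) = (N : ℝ) ^ (8 : ℕ) := by
    rw [show (2 / 3 : ℝ) * (12 : ℕ) = ((8 : ℕ) : ℝ) by norm_num, Real.rpow_natCast]
  have e3 : (P : ℝ) ^ ((1 / 6 : ℝ) * (12 : ℕ)) = (P : ℝ) ^ (2 : ℕ) := by
    rw [show (1 / 6 : ℝ) * (12 : ℕ) = ((2 : ℕ) : ℝ) by norm_num, Real.rpow_natCast]
  have hRHS : 729 * (D : ℝ) ^ (12 * (d' + 1)) * (N : ℝ) ^ (8 : ℕ) =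
      ((3 : ℝ) ^ (1 / 2 : ℝ) * (D : ℝ) ^ (d' + 1) * (N : ℝ) ^ (2 / 3 : ℝ)) ^ (12 : ℕ) := by
    rw [mul_pow, mul_pow, ← Real.rpow_mul_natCast (by norm_num : (0:ℝ) ≤ 3),
      ← Real.rpow_mul_natCast hN0, e1, e2, ← pow_mul, mul_comm (d' + 1) 12]
  have hLHS : (B : ℝ) ^ (12 : ℕ) * (P : ℝ) ^ (2 : ℕ) = ((B : ℝ) * (P : ℝ) ^ (1 / 6 : ℝ)) ^ (12 : ℕ) := by
    rw [mul_pow, ← Real.rpow_mul_natCast hP0.le, e3]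
  rw [hLHS, hRHS] at h'
  have h2 : (B : ℝ) * (P : ℝ) ^ (1 / 6 : ℝ) ≤
      (3 : ℝ) ^ (1 / 2 : ℝ) * (D : ℝ) ^ (d' + 1) * (N : ℝ) ^ (2 / 3 : ℝ) :=
    le_of_pow_le_pow_left₀ (by norm_num) (by positivity) h'
  have h3 : (3 : ℝ) ^ (1 / 2 : ℝ) ≤ 2 := by
    have h9 : (3 : ℝ) ^ (1 / 2 : ℝ) ≤ (4 : ℝ) ^ (1 / 2 : ℝ) :=
      Real.rpow_le_rpow (by norm_num) (by norm_num) (by norm_num)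
    have h4 : (4 : ℝ) ^ (1 / 2 : ℝ) = 2 := by
      rw [show (4 : ℝ) = 2 ^ (2 : ℕ) by norm_num, ← Real.rpow_natCast,
        ← Real.rpow_mul (by norm_num)]
      norm_num
    linarith
  have hP6 : (0 : ℝ) < (P : ℝ) ^ (1 / 6 : ℝ) := Real.rpow_pos_of_pos hP0 _
  rw [le_div_iff₀ hP6]
  calc (B : ℝ) * (P : ℝ) ^ (1 / 6 : ℝ)
      ≤ (3 : ℝ) ^ (1 / 2 : ℝ) * (D : ℝ) ^ (d' + 1) * (N : ℝ) ^ (2 / 3 : ℝ) := h2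
    _ ≤ 2 * (D : ℝ) ^ (d' + 1) * (N : ℝ) ^ (2 / 3 : ℝ) := by gcongr

end AbcShapes

end Literature.NumberTheory.DiophantineGeometry
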